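import Mathlib
import Literature.MathematicalPhysics.QuantumFieldTheory.Balaban1983to89.Setup
import Literature.MathematicalPhysics.QuantumFieldTheory.Balaban1983to89.B6TreeGaugePoincare

/-!
# `Balaban1983to89.B16Sect1Wilson` — T. Bałaban, *Large field renormalization. II. Localization, exponentiation,
and bounds for the 𝐑 operation*, Commun. Math. Phys. **122**, 355–392 (1989) [Balaban1989LargeFieldII] (cell paper
B16; PDF held `paper:balaban1989-cmp122-large-field-ii`, journal page = PDF page + 354): the WILSON-ACTION BOOKKEEPING
of §1, pp. 356–365 — formulas (1.6)–(1.11), (1.14), (1.15), (1.18), (1.30), (1.31), (1.33), (1.34) and the coupling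
function of p. 365 — typed at statement level (mega-formalization `lit-balaban`, reader/typer block r13).

Statement-level skeleton of published theorems with citation tags; proofs where landed; nothing here is a claim about
the Yang–Mills mass gap.

WHAT IS HERE.  (a) The LOCALIZED (plaquette-weighted) Wilson action `A(ζ, U) = Σ_p ζ(p)[1 − Re tr U(∂p)]` on the shared
carrier of `…Balaban1983to89.Setup` (`wilsonLoc`; the series writes `A(ζ₀, U)`, `A(1 − ζ₀, U)`, `A(1/(g_k(·))², U)` for
smooth cut-offs `ζ₀, ζ₁` and for the coupling function, e.g. (1.1), (1.14)–(1.18), (1.30)–(1.37) here and (1.100) of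
[Balaban1989LargeFieldI]); `Setup.wilsonAction w` is its constant-weight case (`wilsonLoc_const`).  With it the displayed
IDENTITIES (1.14), (1.15), (1.18), (1.30) and the p. 365 recombination *"The sum of the two actions is equal to
−A(1/(g_k(·))², U_k)"* are PROVED (they are linearity of `A(ζ, U)` in the weight; (1.18)/(1.30) need the printed support
proviso `ζ₀ = 1 on supp ζ₁`, made an explicit hypothesis), and the sign half `0 ≤ A(ζ₁, U₀)` of (1.31).  (b) The displayed
BOUNDS (1.6), (1.7), (1.9), (1.11), (1.31) as `Prop`s over real parameters named as printed (the `O(1)`'s are explicit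
constants), with the two pieces of arithmetic the text performs PROVED: (1.6) (substituting `ε_k = g_kA₀p₀(g_k)`,
`exp(−δ dist(Ω_k, Λ)) ≤ exp(−R_k)`, `|Λ| ≤ (100M)⁴`) and (1.7) ∧ (1.8) ⇒ (1.9) under the g_k-smallness clause the text
calls *"for g_k sufficiently small"* (`ineq19_of_17_18`, general `d`; the printed exponent 5 is `d + 1` at `d = 4`).
(c) **(1.8)**, the axial-gauge Poincaré inequality `Σ_{b∈Λ}|B′(b)|² ≤ d(100M)^{d+1}Σ_{p∈Λ}|(∂B′)(p)|²`, PROVED for a CUBIC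
domain `Λ` of side `n ≤ 100M` with the comb tree `G₀` (`ineq18_cube`) — a corollary of the cell's kernel theorem
`B6TreeGaugePoincare.ineq2123` = (2.123) of [Balaban1984PropagatorsII], which is exactly the *"same simple argument as in
the proof of Lemma 2.4 in [11]"* the text cites; the general rectangular parallelepiped and 𝔤-valued `B′` are the typed
leaf `Ineq18` (TODO(general form)).  (d) The definitions (1.10) `E_k(Λ)` (with the elementary rewriting
`−½d(𝔤)log g_k^{−2} = d(𝔤) log g_k`), the number `I(U₀)` it implicitly defines, (1.33) (the new determining set `𝐁_k`),
(1.34) (the glued field `V`) and the coupling function `1/(g_k(·))² = 1/(g″_k(·))² Z^c + 1/(g_k²) Z` of p. 365, as set /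
function algebra over abstract index types.

NOT HERE (reader level, cell DIVERGENCE "schematic typing"): the functional integrals (1.1), (1.2), the variational
problem (1.3)–(1.5), the expansions (1.12)–(1.13), (1.16)–(1.17), (1.19)–(1.29), (1.32), (1.35)–(1.37) — they need the
minimizers `U_{k,Z}`, the operators `H_{1,k}`, `Δ₁(ζ₀)` and the random-walk expansions of [15] = [Balaban1985Variational]
and [13] = [Balaban1985BackgroundPropagators], which the tree carries only abstractly; their inventory with page locators
is the block's `SKELETON-r13.md` (HOME `run/shared/lean/pub/lit-balaban/lit-balaban-r13/`).  Every docstring quotation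
below was re-read on the page renders `run/shared/lean/pub/pub-balaban/b2b-balaban-ref1/pages/1989-cmp122-large-field-II/`
p003–p005, p006, p010, p011 (journal pp. 357–360, 364, 365).
-/

namespace Literature.MathematicalPhysics.QuantumFieldTheory.Balaban1983to89.B16Sect1Wilson

open Literature.MathematicalPhysics.QuantumFieldTheory.Balaban1983to89
open Finset

/-! ## §0. The localized Wilson action `A(ζ, U)` and its weight-linearity -/

section Loc
variable {P : Params} {j : ℕ} {G : Type*} [GaugeGroup G]

/-- The LOCALIZED Wilson action `A(ζ, U) = Σ_p ζ(p) [1 − Re tr U(∂p)]` for a real weight `ζ` on plaquettes (a smooth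
cut-off `ζ₀`, `1 − ζ₀`, `ζ₁`, or the coupling function `1/(g_k(·))²`): the functional written `A(ζ₀, U_{k,Z}(V′_kV_Λ))`
in (1.1) p. 356 and `A(1/(g″_k(·))², U″_k)` on p. 359; `d = 4` (no `η^{d−4}` weight). [cite: Balaban1989LargeFieldII, (1.1) p.356] -/
noncomputable def wilsonLoc (ζ : Plaq P j → ℝ) (U : GaugeField P j G) : ℝ :=
  ∑ p : Plaq P j, ζ p * (1 - reTr (GaugeField.plaqHol U p))

/-- A constant weight `w` gives `Setup.wilsonAction w` — the Wilson action `A^ε(U) = Σ_p ε^{d−4}[1 − Re tr U(∂p)]` of [I] (0.2). [cite: Balaban1987RG1, (0.2) p.252] -/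
theorem wilsonLoc_const (w : ℝ) (U : GaugeField P j G) : wilsonLoc (fun _ => w) U = wilsonAction w U := rfl

/-- `A(1, U) = A(U)`, the `d = 4` Wilson action of [I] (0.2) (the weight `1` case used in (1.15) p. 359). [cite: Balaban1987RG1, (0.2) p.252] -/
theorem wilsonLoc_one (U : GaugeField P j G) : wilsonLoc (fun _ => (1 : ℝ)) U = wilsonAction4 U := rfl

/-- Each plaquette term `1 − Re tr U(∂p)` is nonnegative (normalized trace, `Re tr ≤ 1`). [folklore] -/
private theorem plaqDev_nonneg (U : GaugeField P j G) (p : Plaq P j) : 0 ≤ 1 - reTr (GaugeField.plaqHol U p) := by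
  have := GaugeGroup.reTr_le_one (GaugeField.plaqHol U p)
  linarith

/-- Linearity in the weight: `A(ζ + ζ′, U) = A(ζ, U) + A(ζ′, U)` — the content of the displayed splittings (1.14), (1.15)
p. 359. [cite: Balaban1989LargeFieldII, (1.14)–(1.15) p.359] -/
theorem wilsonLoc_add (ζ ζ' : Plaq P j → ℝ) (U : GaugeField P j G) :
    wilsonLoc (fun p => ζ p + ζ' p) U = wilsonLoc ζ U + wilsonLoc ζ' U := by
  simp only [wilsonLoc, add_mul, Finset.sum_add_distrib]

/-- Homogeneity in the weight: `A(c·ζ, U) = c·A(ζ, U)` — the `(1/g_k²)A(U″_k)` term of (1.14) p. 359. [cite: Balaban1989LargeFieldII, (1.14) p.359] -/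
theorem wilsonLoc_smul (c : ℝ) (ζ : Plaq P j → ℝ) (U : GaugeField P j G) :
    wilsonLoc (fun p => c * ζ p) U = c * wilsonLoc ζ U := by
  simp only [wilsonLoc, Finset.mul_sum, mul_assoc]

/-- `A(ζ, U) ≥ 0` for a nonnegative weight — the first half of (1.31) p. 364 (`0 ≤ A(ζ₁, U₀)`) and p. 368 *"the gauge
field in the Wilson action … is G-valued, hence the action is positive"*. [cite: Balaban1989LargeFieldII, (1.31) p.364] -/
theorem wilsonLoc_nonneg (ζ : Plaq P j → ℝ) (U : GaugeField P j G) (hζ : ∀ p, 0 ≤ ζ p) : 0 ≤ wilsonLoc ζ U :=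
  Finset.sum_nonneg fun p _ => mul_nonneg (hζ p) (plaqDev_nonneg U p)

/-- The counting step behind the upper half of (1.31) p. 364: a weight `0 ≤ ζ ≤ 1` supported in a set `S` of plaquettes
on which every plaquette term is `≤ c` gives `A(ζ, U) ≤ c·|S|` (the text: per-plaquette bound from (1.80) [IV] times the
number of plaquettes in `supp ζ₁ ⊂ Z″_{h+1}`). [cite: Balaban1989LargeFieldII, (1.31) p.364] -/
theorem wilsonLoc_le_card_mul (ζ : Plaq P j → ℝ) (U : GaugeField P j G) (S : Finset (Plaq P j)) (c : ℝ)
    (hζ1 : ∀ p, ζ p ≤ 1) (hsupp : ∀ p, p ∉ S → ζ p = 0)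
    (hdev : ∀ p ∈ S, 1 - reTr (GaugeField.plaqHol U p) ≤ c) : wilsonLoc ζ U ≤ c * S.card := by
  classical
  have hsplit : wilsonLoc ζ U = ∑ p ∈ S, ζ p * (1 - reTr (GaugeField.plaqHol U p)) := by
    unfold wilsonLoc
    refine (Finset.sum_subset (Finset.subset_univ S) ?_).symm
    intro p _ hp
    rw [hsupp p hp, zero_mul]
  rw [hsplit]
  calc ∑ p ∈ S, ζ p * (1 - reTr (GaugeField.plaqHol U p)) ≤ ∑ p ∈ S, c :=
        Finset.sum_le_sum fun p hp =>
          le_trans (mul_le_mul_of_nonneg_right (hζ1 p) (plaqDev_nonneg U p)) (by rw [one_mul]; exact hdev p hp)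
    _ = c * S.card := by rw [Finset.sum_const, nsmul_eq_mul, mul_comm]

/-! ### The displayed weight identities (1.14), (1.15), (1.18), (1.30) and the p. 365 recombination -/

/-- **(1.14)** p. 359 [5], verbatim (render p005): *"A(1/(g″_k(·))², U″_k) = (1/g_k²) A(U″_k) + A(1/(g″_k(·))² − 1/g_k², U″_k)."*
Here `c` = the coupling function `1/(g″_k(·))²` read on plaquettes. PROVED (weight-linearity). [cite: Balaban1989LargeFieldII, (1.14) p.359] -/
theorem eq114 (c : Plaq P j → ℝ) (gk : ℝ) (U : GaugeField P j G) :
    wilsonLoc c U = 1 / gk ^ 2 * wilsonAction4 U + wilsonLoc (fun p => c p - 1 / gk ^ 2) U := by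
  simp only [wilsonLoc, wilsonAction4, wilsonAction, Finset.mul_sum, ← Finset.sum_add_distrib]
  exact Finset.sum_congr rfl fun p _ => by ring

/-- **(1.15)** p. 359 [5], verbatim (render p005): *"A(U″_k) = A(ζ₀, U″_k) + A(1 − ζ₀, U″_k)."* PROVED. [cite: Balaban1989LargeFieldII, (1.15) p.359] -/
theorem eq115 (ζ₀ : Plaq P j → ℝ) (U : GaugeField P j G) :
    wilsonAction4 U = wilsonLoc ζ₀ U + wilsonLoc (fun p => 1 - ζ₀ p) U := by
  simp only [wilsonLoc, wilsonAction4, wilsonAction, ← Finset.sum_add_distrib]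
  exact Finset.sum_congr rfl fun p _ => by ring

/-- **(1.18)** p. 360 [6], verbatim (render p006): *"We take a function ζ₁ ∈ C₀^∞(Z″_{h+1}), which changes from 0 to 1 on
a neighborhood of the boundary ∂Z″_{h+1} (on a layer of the width 2 at the boundary, in L^{−h}-scale). We divide this
term again: A(ζ₀, U″_{k,Z}) = A(ζ₀(1 − ζ₁), U″_{k,Z}) + A(ζ₁, U″_{k,Z}). (1.18) Denote ζ₀(1 − ζ₁) = ζ."* — an identity
exactly when `ζ₀ζ₁ = ζ₁`, i.e. `ζ₀ = 1` on `supp ζ₁` (true in the text's geometry: `supp ζ₁ ⊂ Z″_{h+1}` lies inside the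
region where `ζ₀ = 1`; cell transcript note at (1.18)); typed with that proviso as the hypothesis `h`. PROVED. [cite: Balaban1989LargeFieldII, (1.18) p.360] -/
theorem eq118 (ζ₀ ζ₁ : Plaq P j → ℝ) (U : GaugeField P j G) (h : ∀ p, ζ₁ p ≠ 0 → ζ₀ p = 1) :
    wilsonLoc ζ₀ U = wilsonLoc (fun p => ζ₀ p * (1 - ζ₁ p)) U + wilsonLoc ζ₁ U := by
  simp only [wilsonLoc, ← Finset.sum_add_distrib]
  refine Finset.sum_congr rfl fun p _ => ?_
  by_cases hp : ζ₁ p = 0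
  · rw [hp]; ring
  · rw [h p hp]; ring

/-- **(1.30)** p. 364 [10], verbatim (render p010): *"Thus we have proved that in the combined expansions (1.20), (1.24)
all terms are small, except the Wilson action term on the right-hand side of (1.24). This term is equal to A(ζ, U₀) =
A(ζ₀, U₀) − A(ζ₁, U₀). (1.30)"* with `ζ = ζ₀(1 − ζ₁)`; same support proviso as (1.18). PROVED. [cite: Balaban1989LargeFieldII, (1.30) p.364] -/
theorem eq130 (ζ₀ ζ₁ : Plaq P j → ℝ) (U₀ : GaugeField P j G) (h : ∀ p, ζ₁ p ≠ 0 → ζ₀ p = 1) :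
    wilsonLoc (fun p => ζ₀ p * (1 - ζ₁ p)) U₀ = wilsonLoc ζ₀ U₀ - wilsonLoc ζ₁ U₀ := by
  rw [eq118 ζ₀ ζ₁ U₀ h]; ring

end Loc

/-! ## §1. The coupling function of p. 365 and the glued data (1.33), (1.34) -/

section Glue
variable {α : Type*}

/-- p. 365 [11], verbatim (render p011): *"We define also the new function 1/(g_k(·))² = 1/(g″_k(·))²Z^c + 1/(g_k²)Z. We
use here and above the same notation for a set, and for its characteristic function."* — over an abstract index type
(`cOld` = `1/(g″_k(·))²`, `Z` the large-field region read on that index type). [cite: Balaban1989LargeFieldII, p.365 (after (1.35))] -/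
noncomputable def couplingGlue (cOld : α → ℝ) (gk : ℝ) (Z : Set α) : α → ℝ :=
  fun x => cOld x * Zᶜ.indicator 1 x + 1 / gk ^ 2 * Z.indicator 1 x

/-- On `Z` the coupling function of p. 365 is the constant `1/g_k²`. [cite: Balaban1989LargeFieldII, p.365 (after (1.35))] -/
theorem couplingGlue_of_mem (cOld : α → ℝ) (gk : ℝ) {Z : Set α} {x : α} (hx : x ∈ Z) :
    couplingGlue cOld gk Z x = 1 / gk ^ 2 := by
  simp [couplingGlue, Set.indicator_of_mem hx, Set.indicator_of_notMem (Set.notMem_compl_iff.mpr hx)]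

/-- Off `Z` the coupling function of p. 365 is the old one `1/(g″_k(·))²`. [cite: Balaban1989LargeFieldII, p.365 (after (1.35))] -/
theorem couplingGlue_of_not_mem (cOld : α → ℝ) (gk : ℝ) {Z : Set α} {x : α} (hx : x ∉ Z) :
    couplingGlue cOld gk Z x = cOld x := by
  simp [couplingGlue, Set.indicator_of_notMem hx, Set.indicator_of_mem (Set.mem_compl hx)]

/-- **(1.33)** p. 365 [11], verbatim (render p011): *"Now we introduce a new determining set 𝐁_k, and a new background
field U_k. We define 𝐁_k as equal to 𝐁″_k on Z^c, and to {Z^{(k)}} on Z. More precisely 𝐁_k = {Γ_j}, where Γ_j = Γ″_j ∩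
Z^c for j < k, Γ_k = Γ″_k ∪ Z^{(k)}. (1.33)"* — as set algebra over one ambient index type carrying all scales (`Γ''` the
old determining set `𝐁″_k = {Γ″_j}`, `Zk` = `Z^{(k)}`, the `L^{−k}`… k-lattice part of `Z`); values at `j > k` are not used
by the text (here: the `j = k` clause). [cite: Balaban1989LargeFieldII, (1.33) p.365] -/
def detSet133 (Γ'' : ℕ → Set α) (Z Zk : Set α) (k : ℕ) : ℕ → Set α :=
  fun j => if j < k then Γ'' j ∩ Zᶜ else Γ'' k ∪ Zk

/-- (1.33), the clause `j < k`: `Γ_j = Γ″_j ∩ Z^c`. [cite: Balaban1989LargeFieldII, (1.33) p.365] -/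
theorem detSet133_of_lt (Γ'' : ℕ → Set α) (Z Zk : Set α) {k j : ℕ} (h : j < k) :
    detSet133 Γ'' Z Zk k j = Γ'' j ∩ Zᶜ := if_pos h

/-- (1.33), the clause `j = k`: `Γ_k = Γ″_k ∪ Z^{(k)}`. [cite: Balaban1989LargeFieldII, (1.33) p.365] -/
theorem detSet133_self (Γ'' : ℕ → Set α) (Z Zk : Set α) (k : ℕ) :
    detSet133 Γ'' Z Zk k k = Γ'' k ∪ Zk := if_neg (lt_irrefl k)

/-- **(1.34)** p. 365 [11], verbatim (render p011): *"On this determining set we define new gauge field variables V: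
V⌈_{Z^c} = V″⌈_{Z^c}, V⌈_Z = V′_kV_Λ⌈_Z. (1.34) Let us recall that V′_k = 1 on Λ^c, and V_Λ is defined on the whole set
Z^{(k)}, and equal to V_k outside Λ."* — pointwise gluing of bond variables over an abstract bond index type with the
membership predicate `inZ` ("the bond lies in Z"; bonds crossing ∂Λ count as Λ-bonds, [IV] p. 195). [cite: Balaban1989LargeFieldII, (1.34) p.365] -/
def glue134 {G : Type*} [Mul G] (inZ : α → Prop) [DecidablePred inZ] (V'' V'k VΛ : α → G) : α → G :=
  fun b => if inZ b then V'k b * VΛ b else V'' b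

/-- (1.34) on `Z`: `V⌈_Z = V′_kV_Λ⌈_Z`. [cite: Balaban1989LargeFieldII, (1.34) p.365] -/
theorem glue134_of_inZ {G : Type*} [Mul G] (inZ : α → Prop) [DecidablePred inZ] (V'' V'k VΛ : α → G) {b : α}
    (h : inZ b) : glue134 inZ V'' V'k VΛ b = V'k b * VΛ b := if_pos h

/-- (1.34) on `Z^c`: `V⌈_{Z^c} = V″⌈_{Z^c}`. [cite: Balaban1989LargeFieldII, (1.34) p.365] -/
theorem glue134_of_not_inZ {G : Type*} [Mul G] (inZ : α → Prop) [DecidablePred inZ] (V'' V'k VΛ : α → G) {b : α}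
    (h : ¬ inZ b) : glue134 inZ V'' V'k VΛ b = V'' b := if_neg h

end Glue

section Recombine
variable {P : Params} {j : ℕ} {G : Type*} [GaugeGroup G]

/-- p. 365 [11] (render p011), the recombination of the two Wilson terms: *"… with all terms small except the first one,
which in this case is equal to −A((1/(g_k(·))²)(1 − ζ₀), U_k). This expression is now combined together with the Wilson
action in the first exponential in (1.1) … The sum of the two actions is equal to −A(1/(g_k(·))², U_k), which is the new
Wilson action term for a final effective action"* — i.e. `(1/g_k²)A(ζ₀, U_k) + A((1/(g_k(·))²)(1 − ζ₀), U_k) =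
A(1/(g_k(·))², U_k)`, valid because `1/(g_k(·))² = 1/g_k²` on `Z ⊇ supp ζ₀` (hypothesis `hζ`). PROVED. [cite: Balaban1989LargeFieldII, p.365 (before (1.37))] -/
theorem wilson_recombine_p365 (cOld : Plaq P j → ℝ) (gk : ℝ) (Z : Set (Plaq P j)) (ζ₀ : Plaq P j → ℝ)
    (U : GaugeField P j G) (hζ : ∀ p, ζ₀ p ≠ 0 → p ∈ Z) :
    1 / gk ^ 2 * wilsonLoc ζ₀ U + wilsonLoc (fun p => couplingGlue cOld gk Z p * (1 - ζ₀ p)) U =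
      wilsonLoc (couplingGlue cOld gk Z) U := by
  simp only [wilsonLoc, Finset.mul_sum, ← Finset.sum_add_distrib]
  refine Finset.sum_congr rfl fun p _ => ?_
  by_cases hp : ζ₀ p = 0
  · rw [hp]; ring
  · rw [couplingGlue_of_mem cOld gk (hζ p hp)]; ring

end Recombine

/-! ## §2. (1.10), (1.11): the constant `E_k(Λ)` and the number `I(U₀)` of the denominator of (1.1) -/

/-- **(1.10)** p. 358 [4], the constant, verbatim (render p004): *"E_k(Λ) = (−½ d(𝐠) log g_k^{−2} + log σ₀)|Λ^{(k)}∖G₀|"*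
(`dg` = `d(𝐠)` the dimension of the Lie algebra, `σ₀` the normalisation of the Haar chart of (2.8)/(1.2), `n` = the number
of k-lattice bonds of `Λ` off the axial-gauge tree `G₀`). [cite: Balaban1989LargeFieldII, (1.10) p.358] -/
noncomputable def Ek110 (dg gk σ₀ : ℝ) (n : ℕ) : ℝ :=
  (-(1 / 2) * dg * Real.log ((gk ^ 2)⁻¹) + Real.log σ₀) * n

/-- (1.10) rewritten: `−½ d(𝐠) log g_k^{−2} = d(𝐠) log g_k`, so `E_k(Λ) = (d(𝐠) log g_k + log σ₀)|Λ^{(k)}∖G₀|` (elementary;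
unconditional under Mathlib's conventions for `Real.log`). [cite: Balaban1989LargeFieldII, (1.10) p.358] -/
theorem Ek110_eq (dg gk σ₀ : ℝ) (n : ℕ) :
    Ek110 dg gk σ₀ n = (dg * Real.log gk + Real.log σ₀) * n := by
  unfold Ek110
  rw [Real.log_inv, Real.log_pow]
  push_cast
  ring

/-- **(1.10)** p. 358 [4], the identity, verbatim (render p004): *"(∫dV′⌈_Λ δ_{G₀}(V′)χ exp[−(1/g_k²)A(ζ₀, U_{k,Z}(V′V_Λ))])^{−1}
= exp[+(1/g_k²)A(ζ₀, U₀) + I(U₀) − E_k(Λ)]"* — given the value `Z > 0` of the integral, the Wilson term `A₀ = A(ζ₀, U₀)`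
and `E = E_k(Λ)`, this DEFINES the number `I(U₀)`; typed as that number. [cite: Balaban1989LargeFieldII, (1.10) p.358] -/
noncomputable def I110 (gk A₀ E Z : ℝ) : ℝ := -Real.log Z - 1 / gk ^ 2 * A₀ + E

/-- (1.10) holds with `I(U₀) := I110` (for a positive integral). PROVED. [cite: Balaban1989LargeFieldII, (1.10) p.358] -/
theorem eq110 (gk A₀ E Z : ℝ) (hZ : 0 < Z) : Z⁻¹ = Real.exp (1 / gk ^ 2 * A₀ + I110 gk A₀ E Z - E) := by
  have : 1 / gk ^ 2 * A₀ + I110 gk A₀ E Z - E = -Real.log Z := by unfold I110; ring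
  rw [this, Real.exp_neg, Real.exp_log hZ]

/-- **(1.11)** p. 358 [4], verbatim (render p004): *"and the analytically extended I(U₀) satisfies the bound |I(U₀)| <
O(1) log M|Λ| < O(1)M⁵. (1.11)"* — the two printed inequalities with their `O(1)`'s as explicit constants `C`, `C'`
(`volΛ` = `|Λ|`, the number of unit-lattice points of `Λ ⊂` a cube of size `100M`). [cite: Balaban1989LargeFieldII, (1.11) p.358] -/
def Ineq111 (I C C' M volΛ : ℝ) : Prop :=
  |I| < C * Real.log M * volΛ ∧ C * Real.log M * volΛ < C' * M ^ 5

/-- The arithmetic of the second inequality of (1.11) p. 358 (*"O(1) log M|Λ| < O(1)M⁵"*): `|Λ| ≤ (100M)⁴` (Λ in a cube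
of size 100M, d = 4) and `log M ≤ M` give `C log M |Λ| ≤ (C·100⁴) M⁵` for `C ≥ 0`, `M ≥ 1`. PROVED. [cite: Balaban1989LargeFieldII, (1.11) p.358] -/
theorem ineq111_arith (C M volΛ : ℝ) (hC : 0 ≤ C) (hM : 1 ≤ M) (hvol0 : 0 ≤ volΛ) (hvol : volΛ ≤ (100 * M) ^ 4) :
    C * Real.log M * volΛ ≤ C * 100 ^ 4 * M ^ 5 := by
  have hlog : Real.log M ≤ M := (Real.log_le_sub_one_of_pos (by linarith)).trans (by linarith)
  have hlog0 : 0 ≤ Real.log M := Real.log_nonneg hM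
  calc C * Real.log M * volΛ ≤ C * M * (100 * M) ^ 4 :=
        mul_le_mul (mul_le_mul_of_nonneg_left hlog hC) hvol hvol0 (by positivity)
    _ = C * 100 ^ 4 * M ^ 5 := by ring

/-! ## §3. (1.6): the linear term of (1.2) after (1.5) -/

/-- **(1.6)** p. 357 [3], verbatim (render p003): *"By the exponential decay of the minimizer, and the localizations of
1 − ζ₀ and B′, the expression on the right-hand side above [(1.5)] can be bounded by (1/g_k)B₃M₀A₀p₀(g_k)exp(−δ dist(Ω_k,
Λ))3ε_k|Λ| < 3B₃M₀A₀²p₀²(g_k)exp(−R_k)(100M)⁴, (1.6) where we have used the fact that Λ is contained in a cube of the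
size 100M. The bound on the right-hand side above can be made arbitrarily small for sufficiently small g_k, but it is
enough to have an absolute bound, e.g., the number 1."* — the bound itself as a `Prop` on the value `T` of the linear term. [cite: Balaban1989LargeFieldII, (1.6) p.357] -/
def Ineq16 (T B₃ M₀ A₀ p₀g Rk M : ℝ) : Prop :=
  |T| < 3 * B₃ * M₀ * A₀ ^ 2 * p₀g ^ 2 * Real.exp (-Rk) * (100 * M) ^ 4

/-- The arithmetic of (1.6), PROVED: with `ε_k = g_kA₀p₀(g_k)` ([III] (2.2)), `δ·dist(Ω_k, Λ) ≥ R_k` and `|Λ| ≤ (100M)⁴`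
the middle expression of (1.6) is at most its right-hand side. [cite: Balaban1989LargeFieldII, (1.6) p.357] -/
theorem ineq16_arith (gk B₃ M₀ A₀ p₀g δ dist εk volΛ Rk M : ℝ) (hgk : 0 < gk) (hB : 0 ≤ B₃) (hM₀ : 0 ≤ M₀)
    (hε : εk = gk * A₀ * p₀g) (hdist : Rk ≤ δ * dist) (hvol0 : 0 ≤ volΛ) (hvol : volΛ ≤ (100 * M) ^ 4) :
    1 / gk * B₃ * M₀ * A₀ * p₀g * Real.exp (-(δ * dist)) * (3 * εk) * volΛ ≤
      3 * B₃ * M₀ * A₀ ^ 2 * p₀g ^ 2 * Real.exp (-Rk) * (100 * M) ^ 4 := by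
  subst hε
  have h1 : 1 / gk * B₃ * M₀ * A₀ * p₀g * Real.exp (-(δ * dist)) * (3 * (gk * A₀ * p₀g)) * volΛ =
      (3 * B₃ * M₀ * A₀ ^ 2 * p₀g ^ 2) * (Real.exp (-(δ * dist)) * volΛ) := by
    field_simp
  rw [h1]
  have h2 : Real.exp (-(δ * dist)) * volΛ ≤ Real.exp (-Rk) * (100 * M) ^ 4 :=
    mul_le_mul (Real.exp_le_exp.mpr (by linarith)) hvol hvol0 (Real.exp_pos _).le
  calc (3 * B₃ * M₀ * A₀ ^ 2 * p₀g ^ 2) * (Real.exp (-(δ * dist)) * volΛ)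
      ≤ (3 * B₃ * M₀ * A₀ ^ 2 * p₀g ^ 2) * (Real.exp (-Rk) * (100 * M) ^ 4) :=
        mul_le_mul_of_nonneg_left h2 (by positivity)
    _ = _ := by ring

/-! ## §4. (1.7)–(1.9): the quadratic form of (1.2) is bounded below -/

/-- **(1.7)** p. 358 [4], verbatim (render p004): *"Now the leading quadratic form is equal to ⟨B′, Δ_kB′⟩ defined by (1.65),
(1.66) [10]. Using the bound (1.67) [10] for this form, we obtain ⟨H_{1,k}B′, Δ₁(ζ₀)H_{1,k}B′⟩ ≧ γ₀‖∂B′‖² −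
O(1)(M⁶R_kε_k + exp(−R_k))‖B′‖². (1.7)"* ([10] = [Balaban1984PropagatorsI]) — over the three real numbers `Q` = the
form, `ndB` = `‖∂B′‖²`, `nB` = `‖B′‖²`, the `O(1)` an explicit `C`. [cite: Balaban1989LargeFieldII, (1.7) p.358] -/
def Ineq17 (Q ndB nB γ₀ C M Rk εk : ℝ) : Prop :=
  γ₀ * ndB - C * (M ^ 6 * Rk * εk + Real.exp (-Rk)) * nB ≤ Q

/-- **(1.8)** p. 358 [4], verbatim (render p004): *"Consider the quadratic form ‖∂B′‖² on the fields B′ defined on Λ, and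
equal to 0 on bonds of the graph G₀. Using the fact that Λ is a rectangular parallelepiped contained in a cube of the
size 100M, and that G₀ determines the axial gauge in Λ, we obtain the inequality Σ_{b∈Λ}|B′(b)|² ≦ d(100M)^{d+1}
Σ_{p∈Λ}|(∂B′)(p)|². (1.8) It follows by the same simple argument as in the proof of Lemma 2.4 in [11], it is even simpler
in this case, because we do not have the averaging operations."* ([11] = [Balaban1984PropagatorsII]) — the shape over
`nB`, `ndB`; the lattice statement is PROVED for cubic `Λ` below (`ineq18_cube`).  The text's aside *"if in this domain
Λ we fix an axial gauge in the direction of x₁-axis … then the inequality (1.8) holds with the constant (100M)³"* is not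
typed (cell GAPS G-r2.9: not load-bearing). [cite: Balaban1989LargeFieldII, (1.8) p.358] -/
def Ineq18 (nB ndB : ℝ) (d : ℕ) (M : ℝ) : Prop :=
  nB ≤ d * (100 * M) ^ (d + 1) * ndB

/-- **(1.9)** p. 358 [4], verbatim (render p004): *"The inequalities (1.7), (1.8) imply finally ⟨H_{1,k}B′, Δ₁(ζ₀)H_{1,k}B′⟩
≧ γ₀/(2d(100M)⁵) ‖B′‖², (1.9) for g_k sufficiently small. The above inequality holds for U₀ in an arbitrary gauge."* —
typed for general `d` with the exponent `d + 1` that (1.7) ∧ (1.8) actually give (= the printed 5 at `d = 4`). [cite: Balaban1989LargeFieldII, (1.9) p.358] -/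
def Ineq19 (Q nB γ₀ : ℝ) (d : ℕ) (M : ℝ) : Prop :=
  γ₀ / (2 * d * (100 * M) ^ (d + 1)) * nB ≤ Q

/-- (1.7) ∧ (1.8) ⇒ (1.9), PROVED, with *"for g_k sufficiently small"* made explicit: the correction of (1.7) must satisfy
`O(1)(M⁶R_kε_k + e^{−R_k}) ≤ γ₀/(2d(100M)^{d+1})` (a smallness condition on `g_k` at FIXED `M`; cell transcript [chk] at
(1.9)). [cite: Balaban1989LargeFieldII, (1.9) p.358] -/
theorem ineq19_of_17_18 {Q ndB nB γ₀ C M Rk εk : ℝ} {d : ℕ} (hd : 1 ≤ d) (hM : 0 < M) (hγ : 0 ≤ γ₀)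
    (hnB : 0 ≤ nB) (h17 : Ineq17 Q ndB nB γ₀ C M Rk εk) (h18 : Ineq18 nB ndB d M)
    (hsmall : C * (M ^ 6 * Rk * εk + Real.exp (-Rk)) ≤ γ₀ / (2 * d * (100 * M) ^ (d + 1))) :
    Ineq19 Q nB γ₀ d M := by
  unfold Ineq17 at h17
  unfold Ineq18 at h18
  unfold Ineq19
  have hd0 : (0 : ℝ) < d := by exact_mod_cast hd
  have hK : (0 : ℝ) < d * (100 * M) ^ (d + 1) := by positivity
  have h1 : γ₀ * nB / (d * (100 * M) ^ (d + 1)) ≤ γ₀ * ndB := by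
    rw [div_le_iff₀ hK]
    calc γ₀ * nB ≤ γ₀ * (d * (100 * M) ^ (d + 1) * ndB) := mul_le_mul_of_nonneg_left h18 hγ
      _ = γ₀ * ndB * (d * (100 * M) ^ (d + 1)) := by ring
  have h2 : C * (M ^ 6 * Rk * εk + Real.exp (-Rk)) * nB ≤ γ₀ / (2 * d * (100 * M) ^ (d + 1)) * nB :=
    mul_le_mul_of_nonneg_right hsmall hnB
  have h3 : γ₀ / (2 * d * (100 * M) ^ (d + 1)) * nB =
      γ₀ * nB / (d * (100 * M) ^ (d + 1)) - γ₀ / (2 * d * (100 * M) ^ (d + 1)) * nB := by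
    field_simp
    ring
  linarith [h17, h1, h2, h3]

/-- **(1.8) for a cubic domain, PROVED.**  On the concrete unit-lattice carrier of the cell's module
`B6TreeGaugePoincare` (sites `Fin d → ℤ`, bonds `(z, μ)` = ⟨z, z + e_μ⟩, real bond functions `B`, plaquette derivative
`curl`, the cube `B6Elimination.block n y` of side `n` at corner `y`, its inner bonds / plaquettes, and the comb tree
`B6BondElimination.treeBonds n y` — the axial gauge `G₀` of a cube): if `B′ = 0` on the tree and `n ≤ 100M`, then
`Σ_{b⊂Λ}|B′(b)|² ≤ d(100M)^{d+1} Σ_{p⊂Λ}|(∂B′)(p)|²`.  This is (2.123) of [Balaban1984PropagatorsII]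
(`B6TreeGaugePoincare.ineq2123`, constant `d n^d`) followed by `n^d ≤ (100M)^{d+1}` — literally *"the same simple argument
as in the proof of Lemma 2.4 in [11]"*.  TODO(general form): rectangular parallelepipeds (constant unchanged) and
𝔤-valued `B′` (apply componentwise in an orthonormal basis). [cite: Balaban1989LargeFieldII, (1.8) p.358] -/
theorem ineq18_cube {d n : ℕ} (M : ℕ) (hn : 1 ≤ n) (hnM : n ≤ 100 * M) (y : Fin d → ℤ)
    (B : B6TreeGaugePoincare.Cfg d) (hB : ∀ b ∈ B6BondElimination.treeBonds n y, B b = 0) :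
    ∑ b ∈ B6TreeGaugePoincare.innerBonds n y, B b ^ 2 ≤
      (d : ℝ) * (100 * (M : ℝ)) ^ (d + 1) *
        ∑ p ∈ B6TreeGaugePoincare.innerPlaq n y, B6TreeGaugePoincare.curl B p.1 p.2.1 p.2.2 ^ 2 := by
  refine le_trans (B6TreeGaugePoincare.ineq2123 hn y B hB)
    (mul_le_mul_of_nonneg_right ?_ (Finset.sum_nonneg fun _ _ => sq_nonneg _))
  have h1 : (n : ℝ) ≤ 100 * (M : ℝ) := by exact_mod_cast hnM
  have h2 : (1 : ℝ) ≤ 100 * (M : ℝ) := le_trans (by exact_mod_cast hn) h1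
  have h3 : (n : ℝ) ^ d ≤ (100 * (M : ℝ)) ^ d := pow_le_pow_left₀ (Nat.cast_nonneg n) h1 d
  have h4 : (100 * (M : ℝ)) ^ d ≤ (100 * (M : ℝ)) ^ (d + 1) := pow_le_pow_right₀ h2 (Nat.le_succ d)
  exact mul_le_mul_of_nonneg_left (h3.trans h4) (Nat.cast_nonneg d)

/-- The cube case in the typed shape `Ineq18` (with `nB`, `ndB` the two lattice sums). [cite: Balaban1989LargeFieldII, (1.8) p.358] -/
theorem ineq18_of_cube {d n : ℕ} (M : ℕ) (hn : 1 ≤ n) (hnM : n ≤ 100 * M) (y : Fin d → ℤ)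
    (B : B6TreeGaugePoincare.Cfg d) (hB : ∀ b ∈ B6BondElimination.treeBonds n y, B b = 0) :
    Ineq18 (∑ b ∈ B6TreeGaugePoincare.innerBonds n y, B b ^ 2)
      (∑ p ∈ B6TreeGaugePoincare.innerPlaq n y, B6TreeGaugePoincare.curl B p.1 p.2.1 p.2.2 ^ 2) d M :=
  ineq18_cube M hn hnM y B hB

/-! ## §5. (1.31): the ζ₁-localized Wilson term is small -/

/-- **(1.31)** p. 364 [10], verbatim (render p010): *"The second term on the right-hand side can be estimated as follows:
0 ≦ A(ζ₁, U₀) < g_k² L^{−4N} N^{4β₀} O(1) A₀²B₃²B₅²M^{14}R_k⁴p₀²(g_k). (1.31) For N satisfying the conditions discussed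
above the bound on the right-hand side above is small, after dividing by g_k²."* — `A` = `A(ζ₁, U₀)`, `Linv` = `L^{−1}`,
`p₀g` = `p₀(g_k)`, the `O(1)` an explicit `C`; the sign half is `wilsonLoc_nonneg`, the counting step
`wilsonLoc_le_card_mul` (cell transcript [CERT arithmetic] at (1.31): `≤ O(1)M⁴R_{h+1}⁴L^{−4N}` η-plaquettes in `supp ζ₁ ⊂
Z″_{h+1}` times the per-plaquette bound `(O(1)B₃B₅M⁵ε_kη²)²`-type deviation from (1.80) [IV], `ε_k = g_kA₀p₀(g_k)`,
`R_{h+1} ≤ O(1)N^{β₀}R_k`). [cite: Balaban1989LargeFieldII, (1.31) p.364] -/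
def Ineq131 (A gk Linv : ℝ) (N : ℕ) (β₀ C A₀ B₃ B₅ M Rk p₀g : ℝ) : Prop :=
  0 ≤ A ∧ A < gk ^ 2 * Linv ^ (4 * N) * (N : ℝ) ^ (4 * β₀) * C * A₀ ^ 2 * B₃ ^ 2 * B₅ ^ 2 * M ^ 14 * Rk ^ 4 * p₀g ^ 2


/-! ## §6 (v2, append-only). (1.8) for a cubic domain with 𝔤-valued `B′` -/

/-- **(1.8), cubic domain, 𝔤-VALUED `B′` — PROVED** (v2; removes the "𝔤-valued" half of `ineq18_cube`'s TODO): in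
coordinates `a : Fin D` of an orthonormal basis of 𝔤, `|B′(b)|² = Σ_a B′_a(b)²` and `(∂B′)_a = ∂(B′_a)` (`curl` of the
component `fun b => B b a`); summing `ineq18_cube` over `a` gives p. 358 (1.8) *"Σ_{b∈Λ}|B′(b)|² ≦ d(100M)^{d+1}
Σ_{p∈Λ}|(∂B′)(p)|²"* for a cube `Λ` of side `n ≤ 100M` in the comb gauge; rectangular boxes remain TODO. [cite: Balaban1989LargeFieldII, (1.8) p.358] -/
theorem ineq18_cube_vec {d n D : ℕ} (M : ℕ) (hn : 1 ≤ n) (hnM : n ≤ 100 * M) (y : Fin d → ℤ)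
    (B : (Fin d → ℤ) × Fin d → (Fin D → ℝ)) (hB : ∀ b ∈ B6BondElimination.treeBonds n y, B b = 0) :
    ∑ b ∈ B6TreeGaugePoincare.innerBonds n y, ∑ a, (B b a) ^ 2 ≤
      (d : ℝ) * (100 * (M : ℝ)) ^ (d + 1) *
        ∑ p ∈ B6TreeGaugePoincare.innerPlaq n y, ∑ a,
          B6TreeGaugePoincare.curl (fun b => B b a) p.1 p.2.1 p.2.2 ^ 2 := by
  have hcomp := fun a : Fin D => ineq18_cube M hn hnM y (fun b => B b a) (fun b hb => by simp [hB b hb])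
  calc ∑ b ∈ B6TreeGaugePoincare.innerBonds n y, ∑ a, (B b a) ^ 2
      = ∑ a, ∑ b ∈ B6TreeGaugePoincare.innerBonds n y, (B b a) ^ 2 := Finset.sum_comm
    _ ≤ ∑ a : Fin D, (d : ℝ) * (100 * (M : ℝ)) ^ (d + 1) *
          ∑ p ∈ B6TreeGaugePoincare.innerPlaq n y, B6TreeGaugePoincare.curl (fun b => B b a) p.1 p.2.1 p.2.2 ^ 2 :=
        Finset.sum_le_sum fun a _ => hcomp a
    _ = _ := by rw [← Finset.mul_sum, Finset.sum_comm]

end Literature.MathematicalPhysics.QuantumFieldTheory.Balaban1983to89.B16Sect1Wilson
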